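import Mathlib
import HarnessLib.Audit
import Summits.PneNP.PneNP.Theorems.PstarTwoBlockCoincidence

/-!
# The mixed coincidence table `x_a x_b ⊕ x_s(x_p ⊕ x_q)`, by REDUCTION to the two-block table (ROUND-24, O1; memo g26 §68, g27 §69)

FRONTIER range-avoidance ladder, rung F-N3, ROUND 24 (cell `pnp-ideate`, prover-2 memos `g26/O1-LOCALITY-g26.md` §68 and
`g27/O1-PINNING-g27.md` §69; census node `PstarLocalGateBudgetAssembly.LocalMenuCriterionBoundGateBudget`, branch (B) =
`PstarCoincidenceExact.NoCoincidenceExact`; restricted-model proof complexity — nothing here bears on `P` versus `NP`).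

After `PstarPendantCoincidence` (one block, `x_s(x_p ⊕ x_q)`) and `PstarTwoBlockCoincidence` (two disjoint AND pairs, `x_a x_b ⊕ x_c x_d`)
two rank-4 fold shapes of a coincidence remain: the **MIXED** shape `R₁ = x_a x_b ⊕ x_s(x_p ⊕ x_q)` — one free AND pair plus a one-block
pair sharing the literal `s` (e.g. `F₁ = {t₁, t₀, o₀}` behind the chord `(v₂, ℓ₀)` of a pendant partner), local readers on the five variables
`a b s p q` (linear bits `A B S P Q`, monomial bits for the ten pairs) — this file; and the **TWO-CLASS** shape
`x_s(x_p ⊕ x_q) ⊕ x_{s'}(x_{p'} ⊕ x_{q'})` — the companion `PstarTwoClassCoincidence`, by the same method.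

A brute-force `decide` over the `2¹⁶ · 2⁵` configurations is out of the farm's reach (memo g26 §68); instead the table is obtained by the
SUBSTITUTION `u := x_p ⊕ x_q`.  The first reader does not see `x_p` once `u` is fixed, so a second reader that is constant on the slice
`{R₁ = β₁}` cannot depend on `x_p` either: writing the local reader as `L₀(a, b, s, u) ⊕ x_p · slope(a, b, s, u)` (`localVal_false`,
`localVal_true`), joint unsatisfiability is EXACTLY (`unsat_iff_twoBlock`): `L₀` is a two-block coincidence in the block value `u` AND the
slope vanishes on the slice.  The slope is affine in `(a, b, s, u)` up to one term `Mpq·(1 ⊕ u)`, and the slice affinely spans `𝔽₂⁴` at both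
slice values, so "slope vanishes on the slice" is the finite condition `P = Q`, `Map = Maq`, `Mbp = Mbq`, `Msp = Msq`, `Mpq = 0`
(`slope_vanishes_iff`, a `2⁶`-way case split of small `decide`s; reused by the two-class file).  Results:

* **`Mixed.unsat_true_iff`** — slice value `1`: the two-block cross-matrix rule in the block value `u` — `Mab = Msq (= Msp)`,
  `A = Mas ⊕ Maq`, `B = Mbs ⊕ Mbq`, `S = Mas ⊕ Mbs`, `Q (= P) = Maq ⊕ Mbq`, plus `Map = Maq`, `Mbp = Mbq`, `Mpq = 0`; target forced;
* **`Mixed.unsat_false_iff`** — slice value `0`: only the degenerate readers `0`, `R₁`;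
* `Mixed.not_unsat_linear` — no `∅`-menu (linear) coincidence on the mixed shape;
* `Mixed.gval_eq`, `Mixed.coincidence_iff_of_eval` — the bridge from an instance (first reader `gval ∅ {f, t, o}`, five distinct variables).

With `PstarCoincidenceLocality` / `PstarLocalCriterion.coincidence_trunc` (only local readers matter) the two files complete the kernel
(B)-tables for every fold set of rank `< 6` made of at most two AND-classes / private pairs (memo g26 §67–68): one block, two blocks, mixed,
two classes.
-/

set_option linter.dupNamespace false -- `Summit.PneNP.PneNP.…`: summit = sub-problem name (D-0017 single-conjunct layout)

open Finset Literature.Computability.Complexity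
open Summit.PneNP.PneNP.Theorems.PstarFibrePolys (bit bit_xor bit_and bit_injective)
open Summit.PneNP.PneNP.Theorems.PstarGapOneAll (gval)
open Summit.PneNP.PneNP.Theorems.PstarGConstraint (bit_gval)

namespace Summit.PneNP.PneNP.Theorems.PstarMixedCoincidence

open PstarTwoBlockCoincidence renaming localVal → tbVal, Unsat → TBUnsat

variable {n m : ℕ}

/-! ## Small `𝔽₂` facts -/

/-- `bit (!u) = bit u + 1` in `𝔽₂`. -/
private theorem bit_not (u : Bool) : bit (!u) = bit u + 1 := by
  cases u <;> decide

/-- `bit true = 1`. -/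
private theorem bit_true : bit true = 1 := rfl

/-- `bit false = 0`. -/
private theorem bit_false : bit false = 0 := rfl

/-- In `Bool`: from `L ≠ β` and `L ⊕ t ≠ β` conclude `t = false`. -/
private theorem eq_false_of_xor_ne {L t β : Bool} (h₀ : L ≠ β) (h₁ : xor L t ≠ β) : t = false := by
  revert h₀ h₁; cases L <;> cases t <;> cases β <;> decide

/-! ## The slope condition (shared by both shapes) -/

/-- The `x_p`-coefficient of a local reader after the substitution `x_q := u ⊕ x_p`, as a function of the block data `(a, b, s, u)`:
`(P ⊕ Q) ⊕ Mpq·(1 ⊕ u) ⊕ (Map ⊕ Maq)·a ⊕ (Mbp ⊕ Mbq)·b ⊕ (Msp ⊕ Msq)·s`. -/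
def slope (P Q Map Maq Mbp Mbq Msp Msq Mpq a b s u : Bool) : Bool :=
  xor (xor (xor P Q) (Mpq && !u)) (xor (xor (xor Map Maq && a) (xor Mbp Mbq && b)) (xor Msp Msq && s))

/-- **The slope vanishes on the slice `{x_a x_b ⊕ x_s u = β₁}` iff all its coefficients vanish** — at either slice value the slice affinely
spans `𝔽₂⁴` (and contains points with `u = 0` and `u = 1`). -/
theorem slope_vanishes_iff (β₁ P Q Map Maq Mbp Mbq Msp Msq Mpq : Bool) :
    (∀ a b s u : Bool, xor (a && b) (s && u) = β₁ → slope P Q Map Maq Mbp Mbq Msp Msq Mpq a b s u = false) ↔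
      P = Q ∧ Map = Maq ∧ Mbp = Mbq ∧ Msp = Msq ∧ Mpq = false := by
  unfold slope
  cases β₁ <;> cases P <;> cases Q <;> cases Map <;> cases Maq <;> cases Mbp <;> revert Mbq Msp Msq Mpq <;> decide

/-! ## The mixed shape `x_a x_b ⊕ x_s(x_p ⊕ x_q)` -/
namespace Mixed

/-- The local second reader on `(x_a, x_b, x_s, x_p, x_q)`: linear bits `A B S P Q`, monomial bits for the pairs
`ab, as, ap, aq, bs, bp, bq, sp, sq, pq`. -/
def localVal (A B S P Q Mab Mas Map Maq Mbs Mbp Mbq Msp Msq Mpq a b s p q : Bool) : Bool :=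
  xor (xor (xor (A && a) (B && b)) (xor (S && s) (xor (P && p) (Q && q))))
    (xor (xor (xor (Mab && (a && b)) (Mas && (a && s))) (xor (Map && (a && p)) (Maq && (a && q))))
      (xor (xor (Mbs && (b && s)) (xor (Mbp && (b && p)) (Mbq && (b && q)))) (xor (Msp && (s && p)) (xor (Msq && (s && q)) (Mpq && (p && q))))))

/-- The finite unsatisfiability condition: no `(a, b, s, p, q)` with `ab ⊕ s(p ⊕ q) = β₁` and `localVal = β₂`. -/
def Unsat (β₁ β₂ A B S P Q Mab Mas Map Maq Mbs Mbp Mbq Msp Msq Mpq : Bool) : Prop :=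
  ∀ a b s p q : Bool, xor (a && b) (s && xor p q) = β₁ → localVal A B S P Q Mab Mas Map Maq Mbs Mbp Mbq Msp Msq Mpq a b s p q ≠ β₂

/-- **Substitution, `x_p = 0`**: the reader restricted to `x_p = 0` is the two-block reader in `(a, b, s, u)` with fold bits `Mab, Msq` and cross
bits `Mas, Maq, Mbs, Mbq`. -/
theorem localVal_false (A B S P Q Mab Mas Map Maq Mbs Mbp Mbq Msp Msq Mpq a b s u : Bool) :
    localVal A B S P Q Mab Mas Map Maq Mbs Mbp Mbq Msp Msq Mpq a b s false u = tbVal A B S Q Mab Msq Mas Maq Mbs Mbq a b s u := by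
  apply bit_injective
  simp only [localVal, tbVal, bit_xor, bit_and, bit_false]
  ring

/-- **Substitution, `x_p = 1`** (`x_q = 1 ⊕ u`): the reader is the `x_p = 0` reader plus the slope. -/
theorem localVal_true (A B S P Q Mab Mas Map Maq Mbs Mbp Mbq Msp Msq Mpq a b s u : Bool) :
    localVal A B S P Q Mab Mas Map Maq Mbs Mbp Mbq Msp Msq Mpq a b s true (!u) =
      xor (localVal A B S P Q Mab Mas Map Maq Mbs Mbp Mbq Msp Msq Mpq a b s false u) (slope P Q Map Maq Mbp Mbq Msp Msq Mpq a b s u) := by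
  apply bit_injective
  simp only [localVal, slope, bit_xor, bit_and, bit_false, bit_true, bit_not]
  ring

/-- **THE REDUCTION.**  The mixed reader is a coincidence iff its `x_p = 0` part is a two-block coincidence in the block value `u = x_p ⊕ x_q`
and its slope vanishes on the slice. -/
theorem unsat_iff_twoBlock (β₁ β₂ A B S P Q Mab Mas Map Maq Mbs Mbp Mbq Msp Msq Mpq : Bool) :
    Unsat β₁ β₂ A B S P Q Mab Mas Map Maq Mbs Mbp Mbq Msp Msq Mpq ↔
      TBUnsat β₁ β₂ A B S Q Mab Msq Mas Maq Mbs Mbq ∧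
        ∀ a b s u : Bool, xor (a && b) (s && u) = β₁ → slope P Q Map Maq Mbp Mbq Msp Msq Mpq a b s u = false := by
  constructor
  · intro h
    refine ⟨fun a b s u hsl => ?_, fun a b s u hsl => ?_⟩
    · rw [← localVal_false]
      exact h a b s false u (by rwa [Bool.false_xor])
    · have h₀ := h a b s false u (by rwa [Bool.false_xor])
      have h₁ := h a b s true (!u) (by rwa [Bool.true_xor, Bool.not_not])
      rw [localVal_true] at h₁
      exact eq_false_of_xor_ne h₀ h₁
  · rintro ⟨h2, hs⟩ a b s p q hsl
    cases p
    · rw [Bool.false_xor] at hsl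
      rw [localVal_false]
      exact h2 a b s q hsl
    · obtain ⟨u, rfl⟩ : ∃ u, q = !u := ⟨!q, by rw [Bool.not_not]⟩
      rw [Bool.true_xor, Bool.not_not] at hsl
      rw [localVal_true, hs a b s u hsl, Bool.xor_false, localVal_false]
      exact h2 a b s u hsl

/-- **Slice value `1`: the two-block rule in the block value `u = x_p ⊕ x_q`.**  Coincidence iff `Mab = Msq`, the linear reads `A B S Q` are the
row/column sums of the cross matrix `[[Mas, Maq], [Mbs, Mbq]]`, the monomials through `p` copy those through `q` (`Map = Maq`, `Mbp = Mbq`,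
`Msp = Msq`), `P = Q`, `Mpq = 0`; the target is forced. -/
theorem unsat_true_iff (β₂ A B S P Q Mab Mas Map Maq Mbs Mbp Mbq Msp Msq Mpq : Bool) :
    Unsat true β₂ A B S P Q Mab Mas Map Maq Mbs Mbp Mbq Msp Msq Mpq ↔
      (Mab = Msq ∧ A = xor Mas Maq ∧ B = xor Mbs Mbq ∧ S = xor Mas Mbs ∧ Q = xor Maq Mbq ∧ β₂ = !(xor (xor A B) Mab)) ∧
        (P = Q ∧ Map = Maq ∧ Mbp = Mbq ∧ Msp = Msq ∧ Mpq = false) := by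
  rw [unsat_iff_twoBlock, PstarTwoBlockCoincidence.unsat_true_iff, slope_vanishes_iff]

/-- **Slice value `0`: only degenerate readers** (`0`, or `R₁` itself with target `1`). -/
theorem unsat_false_iff (β₂ A B S P Q Mab Mas Map Maq Mbs Mbp Mbq Msp Msq Mpq : Bool) :
    Unsat false β₂ A B S P Q Mab Mas Map Maq Mbs Mbp Mbq Msp Msq Mpq ↔
      A = false ∧ B = false ∧ S = false ∧ P = false ∧ Q = false ∧ Mas = false ∧ Map = false ∧ Maq = false ∧ Mbs = false ∧
        Mbp = false ∧ Mbq = false ∧ Mpq = false ∧ Mab = Msq ∧ Msp = Msq ∧ β₂ = true := by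
  rw [unsat_iff_twoBlock, PstarTwoBlockCoincidence.unsat_false_iff, slope_vanishes_iff]
  constructor
  · rintro ⟨⟨hA, hB, hS, hQ, hMas, hMaq, hMbs, hMbq, hfold, hβ⟩, hPQ, hMap, hMbp, hMsp, hMpq⟩
    subst hA hB hS hQ hMas hMaq hMbs hMbq
    exact ⟨rfl, rfl, rfl, hPQ, rfl, rfl, hMap, rfl, rfl, hMbp, rfl, hMpq, hfold, hMsp, hβ⟩
  · rintro ⟨hA, hB, hS, hP, hQ, hMas, hMap, hMaq, hMbs, hMbp, hMbq, hMpq, hfold, hMsp, hβ⟩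
    subst hA hB hS hP hQ hMas hMap hMaq hMbs hMbp hMbq hMpq
    exact ⟨⟨rfl, rfl, rfl, rfl, rfl, rfl, rfl, rfl, hfold, hβ⟩, rfl, rfl, rfl, hMsp, rfl⟩

/-- In particular **no LINEAR local reader** (all monomial bits `0`, some linear bit `1`) is a coincidence on the mixed shape, either slice value. -/
theorem not_unsat_linear (β₁ β₂ A B S P Q : Bool) (hlin : (A || B || S || P || Q) = true) :
    ¬ Unsat β₁ β₂ A B S P Q false false false false false false false false false false := by
  cases β₁
  · rw [unsat_false_iff]
    revert hlin; cases A <;> cases B <;> cases S <;> cases P <;> cases Q <;> simp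
  · rw [unsat_true_iff]
    revert hlin; cases A <;> cases B <;> cases S <;> cases P <;> cases Q <;> simp

/-! ### The bridge from an instance -/
section Instance

variable (I : LocalMap 4 n m) {f t o : Fin m} {a b s p q : Fin n}

/-- In `𝔽₂`: `bit (ab ⊕ s(p ⊕ q)) = bit a·bit b + bit s·bit p + bit s·bit q`. -/
private theorem bit_mixed (a b s p q : Bool) :
    bit (xor (a && b) (s && xor p q)) = bit a * bit b + bit s * bit p + bit s * bit q := by
  rw [bit_xor, bit_and, bit_and, bit_xor]; ring

/-- **The first reader**: `gval ∅ {f, t, o} = x_a x_b ⊕ x_s(x_p ⊕ x_q)` for members with AND pairs `(a, b)`, `(s, p)`, `(s, q)`. -/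
theorem gval_eq (hft : f ≠ t) (hfo : f ≠ o) (hto : t ≠ o) (hf : I.vars f 2 = a ∧ I.vars f 3 = b) (ht : I.vars t 2 = s ∧ I.vars t 3 = p)
    (ho : I.vars o 2 = s ∧ I.vars o 3 = q) (z : Fin n → Bool) :
    gval I ∅ {f, t, o} z = xor (z a && z b) (z s && xor (z p) (z q)) := by
  classical
  apply bit_injective
  have hf' : f ∉ ({t, o} : Finset (Fin m)) := by simp [hft, hfo]
  rw [bit_gval, sum_empty, zero_add, sum_insert hf', sum_pair hto, hf.1, hf.2, ht.1, ht.2, ho.1, ho.2, bit_mixed]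
  ring

/-- **THE BRIDGE.**  If the two readers evaluate as `R₁` and `localVal` on five distinct variables, joint unsatisfiability over all
assignments is exactly `Unsat`. -/
theorem coincidence_iff_of_eval (hab : a ≠ b) (has : a ≠ s) (hap : a ≠ p) (haq : a ≠ q) (hbs : b ≠ s) (hbp : b ≠ p) (hbq : b ≠ q)
    (hsp : s ≠ p) (hsq : s ≠ q) (hpq : p ≠ q)
    {R₁ R₂ : (Fin n → Bool) → Bool} {A B S P Q Mab Mas Map Maq Mbs Mbp Mbq Msp Msq Mpq : Bool}
    (hR₁ : ∀ z, R₁ z = xor (z a && z b) (z s && xor (z p) (z q)))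
    (hR₂ : ∀ z, R₂ z = localVal A B S P Q Mab Mas Map Maq Mbs Mbp Mbq Msp Msq Mpq (z a) (z b) (z s) (z p) (z q)) (β₁ β₂ : Bool) :
    (∀ z : Fin n → Bool, ¬ (R₁ z = β₁ ∧ R₂ z = β₂)) ↔ Unsat β₁ β₂ A B S P Q Mab Mas Map Maq Mbs Mbp Mbq Msp Msq Mpq := by
  constructor
  · intro h xa xb xs xp xq hR hval
    set z : Fin n → Bool := Function.update (Function.update (Function.update (Function.update (Function.update (fun _ => false)
      a xa) b xb) s xs) p xp) q xq with hz
    have hza : z a = xa := by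
      rw [hz, Function.update_of_ne haq, Function.update_of_ne hap, Function.update_of_ne has, Function.update_of_ne hab,
        Function.update_self]
    have hzb : z b = xb := by
      rw [hz, Function.update_of_ne hbq, Function.update_of_ne hbp, Function.update_of_ne hbs, Function.update_self]
    have hzs : z s = xs := by rw [hz, Function.update_of_ne hsq, Function.update_of_ne hsp, Function.update_self]
    have hzp : z p = xp := by rw [hz, Function.update_of_ne hpq, Function.update_self]
    have hzq : z q = xq := by rw [hz, Function.update_self]
    refine h z ⟨?_, ?_⟩
    · rw [hR₁, hza, hzb, hzs, hzp, hzq]; exact hR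
    · rw [hR₂, hza, hzb, hzs, hzp, hzq]; exact hval
  · rintro h z ⟨e₁, e₂⟩
    rw [hR₁] at e₁
    rw [hR₂] at e₂
    exact h _ _ _ _ _ e₁ e₂

end Instance

end Mixed

end Summit.PneNP.PneNP.Theorems.PstarMixedCoincidence
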